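import Summits.RiemannHypothesis.RiemannHypothesis.Theorems.WeilTwoPrimeDeflM80PBase
import Literature.NumberTheory.LFunctions.WeilBlockRows
import Literature.NumberTheory.LFunctions.WeilBlockRowsDCFast
import HarnessLib

/-!
# Even-sector deflated two-prime certificate M80P: rows 96–99 of the even check `D C = I`

`WeilCert.checkDCRow 0` for certificate M80P, row by row via the linear-traversal check `WeilCert.checkDCRowF` (`decide +kernel`) and `WeilCert.checkDCRow_of_F`. Pure proof file.
-/

set_option linter.dupNamespace false

noncomputable section

namespace Summit.RiemannHypothesis.RiemannHypothesis.Theorems.EvenWinsBeyondArch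

open Literature.NumberTheory.LFunctions

set_option maxHeartbeats 0 in
/-- Fast kernel check of row 96 of the even `D C = I` (certificate M80P; linear traversals). [folklore] -/
theorem checkDCRowF0_96_weilCertDeflM80P : weilCertDeflM80PBase.checkDCRowF 0 96 = true := by
  decide +kernel

/-- Row 96 of the even `D C = I` (certificate M80P), from the fast check. [folklore] -/
theorem checkDCRow0_96_weilCertDeflM80P : weilCertDeflM80PBase.checkDCRow 0 96 = true :=
  WeilCert.checkDCRow_of_F checkDCRowF0_96_weilCertDeflM80P

set_option maxHeartbeats 0 in
/-- Fast kernel check of row 97 of the even `D C = I` (certificate M80P; linear traversals). [folklore] -/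
theorem checkDCRowF0_97_weilCertDeflM80P : weilCertDeflM80PBase.checkDCRowF 0 97 = true := by
  decide +kernel

/-- Row 97 of the even `D C = I` (certificate M80P), from the fast check. [folklore] -/
theorem checkDCRow0_97_weilCertDeflM80P : weilCertDeflM80PBase.checkDCRow 0 97 = true :=
  WeilCert.checkDCRow_of_F checkDCRowF0_97_weilCertDeflM80P

set_option maxHeartbeats 0 in
/-- Fast kernel check of row 98 of the even `D C = I` (certificate M80P; linear traversals). [folklore] -/
theorem checkDCRowF0_98_weilCertDeflM80P : weilCertDeflM80PBase.checkDCRowF 0 98 = true := by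
  decide +kernel

/-- Row 98 of the even `D C = I` (certificate M80P), from the fast check. [folklore] -/
theorem checkDCRow0_98_weilCertDeflM80P : weilCertDeflM80PBase.checkDCRow 0 98 = true :=
  WeilCert.checkDCRow_of_F checkDCRowF0_98_weilCertDeflM80P

set_option maxHeartbeats 0 in
/-- Fast kernel check of row 99 of the even `D C = I` (certificate M80P; linear traversals). [folklore] -/
theorem checkDCRowF0_99_weilCertDeflM80P : weilCertDeflM80PBase.checkDCRowF 0 99 = true := by
  decide +kernel

/-- Row 99 of the even `D C = I` (certificate M80P), from the fast check. [folklore] -/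
theorem checkDCRow0_99_weilCertDeflM80P : weilCertDeflM80PBase.checkDCRow 0 99 = true :=
  WeilCert.checkDCRow_of_F checkDCRowF0_99_weilCertDeflM80P


end Summit.RiemannHypothesis.RiemannHypothesis.Theorems.EvenWinsBeyondArch
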